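import Summits.KontsevichZagierPeriods.KontsevichZagierPeriods.Theorems.HermiteRigidityIslandComplementLandenPrimitives
import Literature.NumberTheory.Transcendental.KZRulesAssociator

/-!
# `ReductionRigidity` (stmt-KontsevichZagierPeriods-3407), line `Sketch`, stub `stub_islandComplement`:
# the Landen certificate, II — Landen's identity as a chain of moves (`stub_boxLanden`)

Route `KontsevichZagierPeriods/HermiteRigidity`, crux `ReductionRigidity` (stmt-3407); growth deliverable
G4 of `Cruxes/ReductionRigidity/STUB-PLAN-stub_islandComplement.md`, part 2 (registered sub-goal stub
`stub_boxLanden`). For every integer `N ≥ 2`,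

  `[□², 2/(N − xy)] − [□², 2/((N − 1) + xy)] + [□², 1/((N − x)(N − y))] ∈ KZ.relations`

(values `2Li₂(1/N)`, `−2Li₂(−1/(N − 1))`, `log²(N/(N − 1))`; this is Landen's identity
`Li₂(z) + Li₂(z/(z − 1)) = −½ log²(1 − z)` at `z = 1/N`) — the first relation of the calculus in the
weight-two box sector that RAISES THE DIMENSION: with the primitives `F₁, F₂, F₃` on `□³` of part I
(`stub_landenPrimitives`, `Fₖ(x, y, t) = 2Eₖ(x, y, t/N)`), three Stokes moves in `t` turn the three
squares into `[□³, ∂ₜFₖ]` (the faces `t = 0` vanish), exactness `∂ₜF₁ = ∂ₓG₁`, `∂ₜF₂ = ∂ₓG₂`,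
`∂ₜF₃ = ∂ₓG₃ + ∂_yH₃` and four Stokes moves in `x`/`y` leave four face functions on `□²` whose sum is
`P − Q` with `Q(u, t) = P(1 − u, t)`, `P = 2N/((N − t)(N − ut))`, and the reflection move
(`stub_reflectAt`) kills `[P] − [Q]`. The bookkeeping is done on `χ`-values for an arbitrary additive
`χ` killing `KZ.relations` (`landen_chi`) and then specialised to the quotient map onto the formal
period ring `KZ.FormalPeriodRing = FormalRep ⧸ relations`.

References: M. Kontsevich, D. Zagier, *Periods* (2001), §1.2 rules (1)–(3)
[cite: KontsevichZagier2001, §1.2]; J. Ayoub, EMS Newsl. 91 (2014), Def. 10 [cite: Ayoub2014, Def. 10].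
No definitions are introduced.
-/

noncomputable section

open MeasureTheory Set MvPolynomial

namespace Summit.KontsevichZagierPeriods.HermiteRigidity.ReductionRigidity

open Literature.NumberTheory.Transcendental
open Literature.NumberTheory.Transcendental.KZ

/-! ## Faces and bounds -/

/-- Inserting a coordinate `c ∈ [0,1]` into a point of `□ⁿ` gives a point of `□ⁿ⁺¹`. [folklore] -/
theorem insertNth_mem_cube {n : ℕ} (i : Fin (n + 1)) {c : ℝ} (hc : 0 ≤ c ∧ c ≤ 1)
    {x : Fin n → ℝ} (hx : x ∈ cube n) : (Fin.insertNth i c x : Fin (n + 1) → ℝ) ∈ cube (n + 1) := by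
  intro j
  induction j using Fin.succAboveCases i with
  | x => rw [Fin.insertNth_apply_same]; exact hc
  | p k => rw [Fin.insertNth_apply_succAbove]; exact hx k

/-- Coordinates of a point of `□²` and their product lie in `[0,1]`. [folklore] -/
theorem landen_face_bounds {x : Fin 2 → ℝ} (hx : x ∈ cube 2) :
    0 ≤ x 0 ∧ x 0 ≤ 1 ∧ 0 ≤ x 1 ∧ x 1 ≤ 1 ∧ 0 ≤ x 0 * x 1 ∧ x 0 * x 1 ≤ 1 :=
  ⟨(hx 0).1, (hx 0).2, (hx 1).1, (hx 1).2, mul_nonneg (hx 0).1 (hx 1).1,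
    mul_le_one₀ (hx 0).2 (hx 1).1 (hx 1).2⟩

/-- The two face functions `P = 2N/((N − t)(N − ut))` and `Q = 2N/((N − t)(N − t + ut))` on `□²`
(coordinates `u = x₀`, `t = x₁`) are regular rational functions there (`N ≥ 2`). [cite: KontsevichZagier2001, §1.1] -/
theorem exists_landen_PQ {N : ℕ} (hN : 2 ≤ N) : ∃ P Q : RFun 2,
    (∀ x ∈ cube 2, P.fn x = 2 * (N:ℝ) / (((N:ℝ) - x 1) * ((N:ℝ) - x 0 * x 1))) ∧
    (∀ x ∈ cube 2, Q.fn x = 2 * (N:ℝ) / (((N:ℝ) - x 1) * ((N:ℝ) - x 1 + x 0 * x 1))) := by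
  have h2 : (2:ℝ) ≤ (N:ℝ) := by exact_mod_cast hN
  have hP : ∀ x ∈ cube 2,
      aeval x ((C (N:ℚ) - X 1) * (C (N:ℚ) - X 0 * X 1) : MvPolynomial (Fin 2) ℚ) ≠ 0 := by
    intro x hx
    have h := landen_face_bounds hx
    simp only [map_sub, map_mul, aeval_C, aeval_X, eq_ratCast, Rat.cast_natCast]
    exact mul_ne_zero (by linarith) (by linarith)
  have hQ : ∀ x ∈ cube 2,
      aeval x ((C (N:ℚ) - X 1) * (C (N:ℚ) - X 1 + X 0 * X 1) : MvPolynomial (Fin 2) ℚ) ≠ 0 := by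
    intro x hx
    have h := landen_face_bounds hx
    simp only [map_sub, map_add, map_mul, aeval_C, aeval_X, eq_ratCast, Rat.cast_natCast]
    exact mul_ne_zero (by linarith) (by linarith)
  exact ⟨⟨C (2 * (N:ℚ)), _, hP⟩, ⟨C (2 * (N:ℚ)), _, hQ⟩, fun x _ => by simp [RFun.fn_apply],
    fun x _ => by simp [RFun.fn_apply]⟩

/-! ## The chain of moves, on `χ`-values -/

section Chi

variable {R : Type} [CommRing R] {χ : KZ.FormalRep →+ R}
variable (hrel : ∀ c ∈ KZ.relations, χ c = 0)
include hrel

/-- **Landen's identity as a chain of moves, `χ`-form**: for every additive `χ` killing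
`KZ.relations`, `χ[□², 2/(N − xy)] − χ[□², 2/((N − 1) + xy)] + χ[□², 1/((N − x)(N − y))] = 0`
(`N ≥ 2`). Seven Stokes moves (`RFun.chi_stokesAt`) and one reflection (`rfun_chi_reflect`), with the
exactness identities of `stub_landenPrimitives`. [cite: KontsevichZagier2001, §1.2 rules (1)–(3)] -/
theorem landen_chi {N : ℕ} (hN : 2 ≤ N) (r r' rP : IntegralRep 2)
    (hr : r.domain = cube 2) (hri : EqOn r.integrand (fun p => 2 / ((N : ℝ) - p 0 * p 1)) (cube 2))
    (hr' : r'.domain = cube 2)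
    (hr'i : EqOn r'.integrand (fun p => 2 / (((N : ℝ) - 1) + p 0 * p 1)) (cube 2))
    (hrP : rP.domain = cube 2)
    (hrPi : EqOn rP.integrand (fun p => 1 / (((N : ℝ) - p 0) * ((N : ℝ) - p 1))) (cube 2)) :
    χ (KZ.of r) - χ (KZ.of r') + χ (KZ.of rP) = 0 := by
  have h2 : (2:ℝ) ≤ (N:ℝ) := by exact_mod_cast hN
  obtain ⟨F₁, G₁, F₂, G₂, F₃, G₃, H₃, hF₁, hF₁', hG₁, hG₁', hF₂, hF₂', hG₂, hG₂', hF₃, hF₃', hG₃,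
    hG₃', hH₃, hH₃'⟩ := stub_landenPrimitives N hN
  obtain ⟨P, Q, hP, hQ⟩ := exists_landen_PQ hN
  have h1 : (0:ℚ) ≤ 1 ∧ (1:ℚ) ≤ 1 := ⟨zero_le_one, le_rfl⟩
  have h0 : (0:ℚ) ≤ 0 ∧ (0:ℚ) ≤ 1 := ⟨le_rfl, zero_le_one⟩
  have m1 : ∀ (i : Fin 3) {x : Fin 2 → ℝ}, x ∈ cube 2 →
      (Fin.insertNth i (((1:ℚ):ℝ)) x : Fin 3 → ℝ) ∈ cube 3 :=
    fun i x hx => insertNth_mem_cube i (by norm_num) hx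
  have m0 : ∀ (i : Fin 3) {x : Fin 2 → ℝ}, x ∈ cube 2 →
      (Fin.insertNth i (((0:ℚ):ℝ)) x : Fin 3 → ℝ) ∈ cube 3 :=
    fun i x hx => insertNth_mem_cube i (by norm_num) hx
  -- the faces `t = 1` are the three squares
  have tF₁ : ∀ x ∈ cube 2, (F₁.faceAt 2 1 h1).fn x = 2 / ((N:ℝ) - x 0 * x 1) := by
    intro x hx
    rw [RFun.fn_faceAt, hF₁ _ (m1 2 hx), insertNth_two_apply_zero, insertNth_two_apply_one,
      insertNth_two_apply_two]
    push_cast; ring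
  have tF₂ : ∀ x ∈ cube 2, (F₂.faceAt 2 1 h1).fn x = -2 / ((N:ℝ) - 1 + x 0 * x 1) := by
    intro x hx
    rw [RFun.fn_faceAt, hF₂ _ (m1 2 hx), insertNth_two_apply_zero, insertNth_two_apply_one,
      insertNth_two_apply_two]
    push_cast; ring
  have tF₃ : ∀ x ∈ cube 2, (F₃.faceAt 2 1 h1).fn x = 1 / (((N:ℝ) - x 0) * ((N:ℝ) - x 1)) := by
    intro x hx
    rw [RFun.fn_faceAt, hF₃ _ (m1 2 hx), insertNth_two_apply_zero, insertNth_two_apply_one,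
      insertNth_two_apply_two]
    push_cast; ring
  -- the faces `t = 0` vanish
  have bF₁ : (F₁.faceAt 2 0 h0).chi χ = 0 := RFun.chi_eq_zero hrel fun x hx => by
    rw [RFun.fn_faceAt, hF₁ _ (m0 2 hx), insertNth_two_apply_two]; push_cast; ring
  have bF₂ : (F₂.faceAt 2 0 h0).chi χ = 0 := RFun.chi_eq_zero hrel fun x hx => by
    rw [RFun.fn_faceAt, hF₂ _ (m0 2 hx), insertNth_two_apply_two]; push_cast; ring
  have bF₃ : (F₃.faceAt 2 0 h0).chi χ = 0 := RFun.chi_eq_zero hrel fun x hx => by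
    rw [RFun.fn_faceAt, hF₃ _ (m0 2 hx), insertNth_two_apply_two]; push_cast; ring
  -- the faces `x = 0` (resp. `y = 0`) of the primitives `Gₖ` (resp. `H₃`) vanish
  have bG₁ : (G₁.faceAt 0 0 h0).chi χ = 0 := RFun.chi_eq_zero hrel fun x hx => by
    rw [RFun.fn_faceAt, hG₁ _ (m0 0 hx), insertNth_zero_apply_zero]; push_cast; ring
  have bG₂ : (G₂.faceAt 0 0 h0).chi χ = 0 := RFun.chi_eq_zero hrel fun x hx => by
    rw [RFun.fn_faceAt, hG₂ _ (m0 0 hx), insertNth_zero_apply_zero]; push_cast; ring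
  have bG₃ : (G₃.faceAt 0 0 h0).chi χ = 0 := RFun.chi_eq_zero hrel fun x hx => by
    rw [RFun.fn_faceAt, hG₃ _ (m0 0 hx), insertNth_zero_apply_zero]; push_cast; ring
  have bH₃ : (H₃.faceAt 1 0 h0).chi χ = 0 := RFun.chi_eq_zero hrel fun x hx => by
    rw [RFun.fn_faceAt, hH₃ _ (m0 1 hx), insertNth_one_apply_one]; push_cast; ring
  -- the faces `x = 1` / `y = 1`: four functions of `(u, t)` on `□²`
  have tG₁ : ∀ x ∈ cube 2, (G₁.faceAt 0 1 h1).fn x = 2 / ((N:ℝ) - x 0 * x 1) := by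
    intro x hx
    rw [RFun.fn_faceAt, hG₁ _ (m1 0 hx), insertNth_zero_apply_zero, insertNth_zero_apply_one,
      insertNth_zero_apply_two]
    push_cast; ring
  have tG₂ : ∀ x ∈ cube 2, (G₂.faceAt 0 1 h1).fn x =
      -(2 * (N:ℝ)) / (((N:ℝ) - x 1) * ((N:ℝ) - x 1 + x 0 * x 1)) := by
    intro x hx
    rw [RFun.fn_faceAt, hG₂ _ (m1 0 hx), insertNth_zero_apply_zero, insertNth_zero_apply_one,
      insertNth_zero_apply_two]
    push_cast; ring
  have tG₃ : ∀ x ∈ cube 2, (G₃.faceAt 0 1 h1).fn x =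
      x 1 / (((N:ℝ) - x 1) * ((N:ℝ) - x 0 * x 1)) := by
    intro x hx
    rw [RFun.fn_faceAt, hG₃ _ (m1 0 hx), insertNth_zero_apply_zero, insertNth_zero_apply_one,
      insertNth_zero_apply_two]
    push_cast; ring
  have tH₃ : ∀ x ∈ cube 2, (H₃.faceAt 1 1 h1).fn x =
      x 1 / (((N:ℝ) - x 0 * x 1) * ((N:ℝ) - x 1)) := by
    intro x hx
    rw [RFun.fn_faceAt, hH₃ _ (m1 1 hx), insertNth_one_apply_zero, insertNth_one_apply_one,
      insertNth_one_apply_two]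
    push_cast; ring
  -- the seven Stokes moves
  have sF₁ := RFun.chi_stokesAt hrel 2 F₁
  have sF₂ := RFun.chi_stokesAt hrel 2 F₂
  have sF₃ := RFun.chi_stokesAt hrel 2 F₃
  have sG₁ := RFun.chi_stokesAt hrel 0 G₁
  have sG₂ := RFun.chi_stokesAt hrel 0 G₂
  have sG₃ := RFun.chi_stokesAt hrel 0 G₃
  have sH₃ := RFun.chi_stokesAt hrel 1 H₃
  -- exactness: `∂ₜF₁ = ∂ₓG₁`, `∂ₜF₂ = ∂ₓG₂`, `∂ₜF₃ = ∂ₓG₃ + ∂_yH₃`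
  have e₁ : (F₁.pd 2).chi χ = (G₁.pd 0).chi χ :=
    RFun.chi_congr hrel fun p hp => by rw [hF₁' p hp, hG₁' p hp]
  have e₂ : (F₂.pd 2).chi χ = (G₂.pd 0).chi χ :=
    RFun.chi_congr hrel fun p hp => by rw [hF₂' p hp, hG₂' p hp]
  have e₃ : (F₃.pd 2).chi χ = (G₃.pd 0).chi χ + (H₃.pd 1).chi χ := by
    rw [← RFun.chi_add hrel]
    exact RFun.chi_congr hrel fun p hp => by rw [RFun.fn_add hp, hF₃' p hp, hG₃' p hp, hH₃' p hp]
  -- the four face functions sum to `P − Q`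
  have eU : ((((G₁.faceAt 0 1 h1).add (G₂.faceAt 0 1 h1)).add (G₃.faceAt 0 1 h1)).add
      (H₃.faceAt 1 1 h1)).chi χ = (P.sub Q).chi χ := by
    refine RFun.chi_congr hrel fun x hx => ?_
    have h := landen_face_bounds hx
    have d1 : (N:ℝ) - x 0 * x 1 ≠ 0 := by linarith
    have d2 : (N:ℝ) - x 1 ≠ 0 := by linarith
    have d3 : (N:ℝ) - x 1 + x 0 * x 1 ≠ 0 := by linarith
    rw [RFun.fn_add hx, RFun.fn_add hx, RFun.fn_add hx, RFun.fn_sub hx, tG₁ x hx, tG₂ x hx,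
      tG₃ x hx, tH₃ x hx, hP x hx, hQ x hx]
    field_simp
    ring
  have eU' : ((((G₁.faceAt 0 1 h1).add (G₂.faceAt 0 1 h1)).add (G₃.faceAt 0 1 h1)).add
      (H₃.faceAt 1 1 h1)).chi χ = (G₁.faceAt 0 1 h1).chi χ + (G₂.faceAt 0 1 h1).chi χ +
        (G₃.faceAt 0 1 h1).chi χ + (H₃.faceAt 1 1 h1).chi χ := by
    rw [RFun.chi_add hrel, RFun.chi_add hrel, RFun.chi_add hrel]
  have ePQ : (P.sub Q).chi χ = P.chi χ - Q.chi χ := RFun.chi_sub hrel P Q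
  -- the reflection `u ↦ 1 − u` carries `P` to `Q`
  have eQ : Q.chi χ = P.chi χ := by
    refine rfun_chi_reflect hrel 0 P Q fun x hx => ?_
    have h := landen_face_bounds hx
    have hx' : Function.update x 0 (1 - x 0) ∈ cube 2 :=
      KZ.update_mem_cube hx 0 (by linarith) (by linarith)
    rw [hQ x hx, hP _ hx', Function.update_self,
      Function.update_of_ne (show (1 : Fin 2) ≠ 0 by decide)]
    ring
  -- the three squares as faces
  have cr : χ (KZ.of r) = (F₁.faceAt 2 1 h1).chi χ :=
    rfun_chi_of_eq hrel _ hr fun x hx => by rw [hri hx, tF₁ x hx]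
  have cr' : χ (KZ.of r') = -(F₂.faceAt 2 1 h1).chi χ := by
    rw [← RFun.chi_neg hrel]
    refine rfun_chi_of_eq hrel _ hr' fun x hx => ?_
    have h := landen_face_bounds hx
    have d : (N:ℝ) - 1 + x 0 * x 1 ≠ 0 := by linarith
    rw [hr'i hx, RFun.fn_neg, tF₂ x hx]
    field_simp
  have crP : χ (KZ.of rP) = (F₃.faceAt 2 1 h1).chi χ :=
    rfun_chi_of_eq hrel _ hrP fun x hx => by rw [hrPi hx, tF₃ x hx]
  linear_combination cr - cr' + crP - sF₁ - sF₂ - sF₃ + bF₁ + bF₂ + bF₃ + e₁ + e₂ + e₃ + sG₁ +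
    sG₂ + sG₃ + sH₃ - bG₁ - bG₂ - bG₃ - bH₃ - eU' + eU + ePQ - eQ

end Chi

/-! ## The registered sub-goal stub -/

/-- **Stub `stub_boxLanden`** (sub-goal of crux `ReductionRigidity`, stmt-3407, line `Sketch`, growth
deliverable G4 for the remainder stub `stub_islandComplement`): **Landen's identity as a chain of
moves.** For every integer `N ≥ 2` and any representations `r, r', rP` on the closed square with the
printed integrands on it,
`[□², 2/(N − xy)] − [□², 2/((N − 1) + xy)] + [□², 1/((N − x)(N − y))] ∈ KZ.relations`
(`2Li₂(1/N) + 2Li₂(−1/(N − 1)) + log²((N − 1)/N) = 0`): `landen_chi` for the quotient map onto the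
formal period ring `FormalRep ⧸ relations`. [cite: KontsevichZagier2001, §1.2 rules (1)–(3)] -/
theorem stub_boxLanden :
    ∀ (N : ℕ), 2 ≤ N → ∀ (r r' rP : IntegralRep 2),
      r.domain = cube 2 → EqOn r.integrand (fun p => 2 / ((N : ℝ) - p 0 * p 1)) (cube 2) →
      r'.domain = cube 2 →
      EqOn r'.integrand (fun p => 2 / (((N : ℝ) - 1) + p 0 * p 1)) (cube 2) →
      rP.domain = cube 2 →
      EqOn rP.integrand (fun p => 1 / (((N : ℝ) - p 0) * ((N : ℝ) - p 1))) (cube 2) →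
      KZ.of r - KZ.of r' + KZ.of rP ∈ KZ.relations := by
  intro N hN r r' rP hr hri hr' hr'i hrP hrPi
  have h := landen_chi (χ := (toFormalPeriod.toAddMonoidHom : FormalRep →+ FormalPeriodRing))
    (fun c hc => toFormalPeriod_eq_zero_of_mem hc) hN r r' rP hr hri hr' hr'i hrP hrPi
  rw [← toFormalPeriod_eq_zero_iff, map_add, map_sub]
  simpa using h

end Summit.KontsevichZagierPeriods.HermiteRigidity.ReductionRigidity

end
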